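import Summits.AtomisticToContinuum.HydrodynamicLimit.Theorems.JaynesSqueezeBlockGibbsToRelEntropyLedger
import Summits.AtomisticToContinuum.HydrodynamicLimit.Theorems.JaynesSqueezeBlockGibbsToRelEntropyPairings
import Summits.AtomisticToContinuum.HydrodynamicLimit.Theorems.JaynesSqueezeBlockGibbsToRelEntropyEntropyConservation
import Summits.AtomisticToContinuum.HydrodynamicLimit.Theorems.JaynesSqueezeBlockGibbsToRelEntropyReduction

/-!
# `BlockGibbsToRelEntropy` (stmt-AtomisticToContinuum-13464), V: Yau's estimate at the Euler-driven reference from convergence of the mean empirical fields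

Route JaynesSqueeze, support item `BlockGibbsToRelEntropy`, step (d) ASSEMBLED ("bookkeeping at the
Euler-driven reference"): the KL core of the item (the hypothesis `core` of
`JaynesSqueezeClosure.blockGibbsToRelEntropy_of_klCore`) at a time `t` follows from

* the STATICS of the reference: the two local-density limits of the log-partition functions
  `(N+1)⁻¹ log Z_N(ρ e^{g_σ(ρ)}, ·, ·) → ∫ ρ · ρσ³ f_ex'(ρσ³)` at `ρ = ρ₀` and `ρ = ρ_t` (conclusion (B) of
  `HardSphereLDA`, taken here as the hypotheses `hZ0`, `hZt`), the representation of the initial activity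
  `a₀ = e^c ρ₀ e^{g_σ(ρ₀)}` (from `HardSphereLDA` (A) and the tie; hypothesis `harepr`) and `θ(0) = θ₀`;
* the DYNAMICS only through CONVERGENCE OF THE MEAN EMPIRICAL FIELDS: at time `0` of the density field
  (`hD0`), at time `t` of the density, momentum and energy fields of `Φ_t z` (`hDt`, `hMt`, `hEt`) — the
  quantity the kinetic closure + `CollisionalFluxLocality` + `EntropicWeakStrongHS` chain of the route is to
  deliver ("MeanFieldsConverge").

Proof (`klCore_at_of_meanFields`): the finite-`N` ledger `toReal_klDiv_lawAt_localGibbsLaw_eq` (part III),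
the limits of its four terms (parts III–IV and the hypotheses), and the cancellation of the limit
(`bookkeeping_limit_eq_zero`: the activity representation, `g_σ(r) = f_ex(rσ³) + rσ³ f_ex'(rσ³)`, Gaussian
equipartition, unit mass and CONSERVATION OF THE THERMODYNAMIC ENTROPY along the classical solution,
`integral_entropy_eq` of part II). No definitions. prover-pitem-stmt-AtomisticToContinuum-13464-0.
-/

noncomputable section

namespace Summit.AtomisticToContinuum.HydrodynamicLimit.Theorems.JaynesSqueezeClosure

open MeasureTheory Filter Set Topology InformationTheory
open scoped ENNReal ContDiff
open Literature.MathematicalPhysics.KineticTheory Literature.Analysis.FluidPDE Literature.Analysis.FunctionSpaces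
open MacroClosureLine.StubLedger JaynesSqueezeSqueeze

variable {σ η₀ T : ℝ} {ρ θ : ℝ → T3 → ℝ} {u : ℝ → T3 → V3} {a₀ θ₀ : T3 → ℝ} {u₀ : T3 → V3}

/-! ### §1 Calculus of the reference activity `ρ e^{g_σ(ρ)}` in the band -/

/-- In the analytic band the conjugate function `g_σ(r) = f_ex(rσ³) + rσ³ f_ex'(rσ³)` is continuous
(on `{r | rσ³ ∈ (0, η₀)}`). [folklore] -/
theorem continuousOn_conj (hf : ContDiffOn ℝ ∞ hsExcessFreeEnergy (Ioo 0 η₀)) :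
    ContinuousOn (fun r : ℝ => hsExcessFreeEnergy (r * σ ^ 3) + r * σ ^ 3 * deriv hsExcessFreeEnergy (r * σ ^ 3))
      {r : ℝ | r * σ ^ 3 ∈ Ioo 0 η₀} := by
  have hf' : ContDiffOn ℝ ∞ (deriv hsExcessFreeEnergy) (Ioo 0 η₀) := hf.deriv_of_isOpen isOpen_Ioo (by simp)
  have hη : Continuous fun r : ℝ => r * σ ^ 3 := continuous_id.mul continuous_const
  have hmaps : MapsTo (fun r : ℝ => r * σ ^ 3) {r : ℝ | r * σ ^ 3 ∈ Ioo 0 η₀} (Ioo 0 η₀) := fun r hr => hr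
  exact (hf.continuousOn.comp hη.continuousOn hmaps).add
    (hη.continuousOn.mul (hf'.continuousOn.comp hη.continuousOn hmaps))

/-- The Euler-driven activity `x ↦ ρ(x) e^{g_σ(ρ(x))}` of a continuous density with values in the band is
continuous. [folklore] -/
theorem continuous_refActivity (hσ : 0 < σ) (hf : ContDiffOn ℝ ∞ hsExcessFreeEnergy (Ioo 0 η₀)) {r : T3 → ℝ}
    (hr : Continuous r) (hr0 : ∀ x, 0 < r x) (hrb : ∀ x, r x * σ ^ 3 < η₀) :
    Continuous fun x => r x * Real.exp (hsExcessFreeEnergy (r x * σ ^ 3) +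
      r x * σ ^ 3 * deriv hsExcessFreeEnergy (r x * σ ^ 3)) := by
  have hg := (continuousOn_conj (σ := σ) hf).comp_continuous hr fun x => ⟨mul_pos (hr0 x) (pow_pos hσ 3), hrb x⟩
  exact hr.mul (Real.continuous_exp.comp hg)

/-- `f_ex(ρσ³)` and `f_ex'(ρσ³)` along a continuous density in the band are continuous. [folklore] -/
theorem continuous_fex_comp (hσ : 0 < σ) (hf : ContDiffOn ℝ ∞ hsExcessFreeEnergy (Ioo 0 η₀)) {r : T3 → ℝ}
    (hr : Continuous r) (hr0 : ∀ x, 0 < r x) (hrb : ∀ x, r x * σ ^ 3 < η₀) :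
    Continuous (fun x => hsExcessFreeEnergy (r x * σ ^ 3)) ∧
      Continuous (fun x => deriv hsExcessFreeEnergy (r x * σ ^ 3)) := by
  have hf' : ContDiffOn ℝ ∞ (deriv hsExcessFreeEnergy) (Ioo 0 η₀) := hf.deriv_of_isOpen isOpen_Ioo (by simp)
  have hη : Continuous fun x => r x * σ ^ 3 := hr.mul continuous_const
  have hmem : ∀ x, r x * σ ^ 3 ∈ Ioo 0 η₀ := fun x => ⟨mul_pos (hr0 x) (pow_pos hσ 3), hrb x⟩
  exact ⟨hf.continuousOn.comp_continuous hη hmem, hf'.continuousOn.comp_continuous hη hmem⟩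

/-! ### §2 The cancellation of the limit -/

/-- **The limit of the normalised relative entropy at the Euler-driven reference vanishes.** With
`g_σ(r) = f_ex(rσ³) + rσ³f_ex'(rσ³)`, the initial activity written as `a₀ = e^c ρ₀ e^{g_σ(ρ₀)}`, `θ(0) = θ₀`,
unit masses `∫ρ₀ = ∫ρ_t = 1`, and conservation of the thermodynamic entropy along the classical solution in the
band (`integral_entropy_eq`): the limit
`[∫ρ₀ log a₀ + ∫ρ₀ log(2πθ₀)^{-3/2} − 3/2] − [∫ρ_t χ₁ + Σⱼ∫(u_tⱼ/θ_t)(ρ_t u_t)ⱼ − ∫E_t/θ_t] + Π_t − (c + Π₀)`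
of the four terms of the ledger is `0` (`χ₁ = log(ρ_t e^{g_σ(ρ_t)}) + log(2πθ_t)^{-3/2} − |u_t|²/(2θ_t)`,
`Π_s = ∫ρ_s · ρ_sσ³ f_ex'(ρ_sσ³)`). [folklore] -/
theorem bookkeeping_limit_eq_zero (hσ : 0 < σ) (hf : ContDiffOn ℝ ∞ hsExcessFreeEnergy (Ioo 0 η₀))
    (hE : IsHardSphereEulerSolution σ T ρ u θ) (hband : ∀ s ∈ Ico 0 T, ∀ x, ρ s x * σ ^ 3 < η₀)
    {t : ℝ} (ht : t ∈ Ico 0 T) (hθ0 : ∀ x, 0 < θ₀ x) (hθeq : θ 0 = θ₀) {c : ℝ}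
    (harepr : ∀ x, a₀ x = Real.exp c * (ρ 0 x * Real.exp (hsExcessFreeEnergy (ρ 0 x * σ ^ 3) +
      ρ 0 x * σ ^ 3 * deriv hsExcessFreeEnergy (ρ 0 x * σ ^ 3))))
    (hmass0 : ∫ x, ρ 0 x = 1) (hmasst : ∫ x, ρ t x = 1) :
    ((∫ x, Real.log (a₀ x) * ρ 0 x) +
          (∫ x, Real.log ((2 * Real.pi * θ₀ x) ^ (-(Module.finrank ℝ V3 : ℝ) / 2)) * ρ 0 x) - 3 / 2) -
        ((∫ x, (Real.log (ρ t x * Real.exp (hsExcessFreeEnergy (ρ t x * σ ^ 3) +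
              ρ t x * σ ^ 3 * deriv hsExcessFreeEnergy (ρ t x * σ ^ 3))) +
            Real.log ((2 * Real.pi * θ t x) ^ (-(Module.finrank ℝ V3 : ℝ) / 2)) -
            ‖u t x‖ ^ 2 / (2 * θ t x)) * ρ t x) +
          (∑ j, ∫ x, (u t x j / θ t x) * ((ρ t x • u t x) j)) -
          ∫ x, (θ t x)⁻¹ * totalEnergyDensity (ρ t x) (u t x) (θ t x)) +
        (∫ x, ρ t x * (ρ t x * σ ^ 3 * deriv hsExcessFreeEnergy (ρ t x * σ ^ 3))) -
        (c + ∫ x, ρ 0 x * (ρ 0 x * σ ^ 3 * deriv hsExcessFreeEnergy (ρ 0 x * σ ^ 3))) = 0 := by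
  have h0 : (0 : ℝ) ∈ Ico 0 T := ⟨le_rfl, ht.1.trans_lt ht.2⟩
  have hfin : (Module.finrank ℝ V3 : ℝ) = 3 := by simp
  -- continuity and positivity of the Euler fields
  have hρ0c : Continuous (ρ 0) := (hE.smooth_density.isSmooth_slice h0).continuous
  have hρtc : Continuous (ρ t) := (hE.smooth_density.isSmooth_slice ht).continuous
  have hθ0c : Continuous θ₀ := hθeq ▸ (hE.smooth_temperature.isSmooth_slice h0).continuous
  have hθtc : Continuous (θ t) := (hE.smooth_temperature.isSmooth_slice ht).continuous
  have hutc : Continuous (u t) := (hE.smooth_velocity.isSmooth_slice ht).continuous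
  have hρ0pos : ∀ x, 0 < ρ 0 x := hE.density_pos 0 h0
  have hρtpos : ∀ x, 0 < ρ t x := hE.density_pos t ht
  have hθtpos : ∀ x, 0 < θ t x := hE.temperature_pos t ht
  obtain ⟨hf0c, hf0c'⟩ := continuous_fex_comp hσ hf hρ0c hρ0pos (hband 0 h0)
  obtain ⟨hftc, hftc'⟩ := continuous_fex_comp hσ hf hρtc hρtpos (hband t ht)
  have h2π : 0 < 2 * Real.pi := mul_pos two_pos Real.pi_pos
  -- conservation of the thermodynamic entropy
  have hS := integral_entropy_eq hσ hf hE hband ht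
  rw [hθeq] at hS
  -- the time-0 terms
  have e1 : (∫ x, Real.log (a₀ x) * ρ 0 x) +
      (∫ x, Real.log ((2 * Real.pi * θ₀ x) ^ (-(Module.finrank ℝ V3 : ℝ) / 2)) * ρ 0 x) =
      c + (∫ x, ρ 0 x * (ρ 0 x * σ ^ 3 * deriv hsExcessFreeEnergy (ρ 0 x * σ ^ 3))) -
        (∫ x, ρ 0 x * (3 / 2 * Real.log (θ₀ x) - Real.log (ρ 0 x) - hsExcessFreeEnergy (ρ 0 x * σ ^ 3))) -
        3 / 2 * Real.log (2 * Real.pi) := by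
    have hpt : ∀ x, Real.log (a₀ x) * ρ 0 x +
        Real.log ((2 * Real.pi * θ₀ x) ^ (-(Module.finrank ℝ V3 : ℝ) / 2)) * ρ 0 x =
        c * ρ 0 x + ρ 0 x * (ρ 0 x * σ ^ 3 * deriv hsExcessFreeEnergy (ρ 0 x * σ ^ 3)) -
          ρ 0 x * (3 / 2 * Real.log (θ₀ x) - Real.log (ρ 0 x) - hsExcessFreeEnergy (ρ 0 x * σ ^ 3)) -
          3 / 2 * Real.log (2 * Real.pi) * ρ 0 x := by
      intro x
      rw [harepr x, Real.log_mul (Real.exp_pos c).ne' (mul_pos (hρ0pos x) (Real.exp_pos _)).ne', Real.log_exp,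
        Real.log_mul (hρ0pos x).ne' (Real.exp_pos _).ne', Real.log_exp, hfin,
        Real.log_rpow (mul_pos h2π (hθ0 x)), Real.log_mul h2π.ne' (hθ0 x).ne']
      ring
    have hI1 : Integrable (fun x => Real.log (a₀ x) * ρ 0 x) := by
      refine integrable_of_continuous_T3 (Continuous.mul ?_ hρ0c)
      have ha0c : Continuous a₀ := by
        have : a₀ = fun x => Real.exp c * (ρ 0 x * Real.exp (hsExcessFreeEnergy (ρ 0 x * σ ^ 3) +
            ρ 0 x * σ ^ 3 * deriv hsExcessFreeEnergy (ρ 0 x * σ ^ 3))) := funext harepr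
        rw [this]
        exact continuous_const.mul (continuous_refActivity hσ hf hρ0c hρ0pos (hband 0 h0))
      exact ha0c.log fun x => by
        rw [harepr x]; exact (mul_pos (Real.exp_pos c) (mul_pos (hρ0pos x) (Real.exp_pos _))).ne'
    have hI2 : Integrable (fun x => Real.log ((2 * Real.pi * θ₀ x) ^ (-(Module.finrank ℝ V3 : ℝ) / 2)) * ρ 0 x) := by
      refine integrable_of_continuous_T3 (Continuous.mul ?_ hρ0c)
      have hRc : Continuous fun x => (2 * Real.pi * θ₀ x) ^ (-(Module.finrank ℝ V3 : ℝ) / 2) :=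
        (continuous_const.mul hθ0c).rpow_const fun x => Or.inl (mul_pos h2π (hθ0 x)).ne'
      exact hRc.log fun x => (Real.rpow_pos_of_pos (mul_pos h2π (hθ0 x)) _).ne'
    have hJ1 : Integrable (fun x => c * ρ 0 x) := integrable_of_continuous_T3 (continuous_const.mul hρ0c)
    have hJ2 : Integrable (fun x => ρ 0 x * (ρ 0 x * σ ^ 3 * deriv hsExcessFreeEnergy (ρ 0 x * σ ^ 3))) :=
      integrable_of_continuous_T3 (hρ0c.mul ((hρ0c.mul continuous_const).mul hf0c'))
    have hJ3 : Integrable (fun x => ρ 0 x * (3 / 2 * Real.log (θ₀ x) - Real.log (ρ 0 x) -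
        hsExcessFreeEnergy (ρ 0 x * σ ^ 3))) :=
      integrable_of_continuous_T3 (hρ0c.mul (((continuous_const.mul (hθ0c.log fun x => (hθ0 x).ne')).sub
        (hρ0c.log fun x => (hρ0pos x).ne')).sub hf0c))
    have hJ4 : Integrable (fun x => 3 / 2 * Real.log (2 * Real.pi) * ρ 0 x) :=
      integrable_of_continuous_T3 (continuous_const.mul hρ0c)
    have hK2 : Integrable (fun x => c * ρ 0 x + ρ 0 x * (ρ 0 x * σ ^ 3 * deriv hsExcessFreeEnergy (ρ 0 x * σ ^ 3))) :=
      hJ1.add hJ2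
    have hK3 : Integrable (fun x => c * ρ 0 x + ρ 0 x * (ρ 0 x * σ ^ 3 * deriv hsExcessFreeEnergy (ρ 0 x * σ ^ 3)) -
        ρ 0 x * (3 / 2 * Real.log (θ₀ x) - Real.log (ρ 0 x) - hsExcessFreeEnergy (ρ 0 x * σ ^ 3))) := hK2.sub hJ3
    rw [← integral_add hI1 hI2, integral_congr_ae (Eventually.of_forall hpt), integral_sub hK3 hJ4,
      integral_sub hK2 hJ3, integral_add hJ1 hJ2, integral_const_mul, integral_const_mul, hmass0]
    ring
  -- the time-t terms
  have e2 : (∫ x, (Real.log (ρ t x * Real.exp (hsExcessFreeEnergy (ρ t x * σ ^ 3) +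
        ρ t x * σ ^ 3 * deriv hsExcessFreeEnergy (ρ t x * σ ^ 3))) +
        Real.log ((2 * Real.pi * θ t x) ^ (-(Module.finrank ℝ V3 : ℝ) / 2)) - ‖u t x‖ ^ 2 / (2 * θ t x)) * ρ t x) +
      (∑ j, ∫ x, (u t x j / θ t x) * ((ρ t x • u t x) j)) -
      (∫ x, (θ t x)⁻¹ * totalEnergyDensity (ρ t x) (u t x) (θ t x)) =
      (∫ x, ρ t x * (ρ t x * σ ^ 3 * deriv hsExcessFreeEnergy (ρ t x * σ ^ 3))) -
        (∫ x, ρ t x * (3 / 2 * Real.log (θ t x) - Real.log (ρ t x) - hsExcessFreeEnergy (ρ t x * σ ^ 3))) -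
        3 / 2 * Real.log (2 * Real.pi) - 3 / 2 := by
    have hsum : ∀ x, ∑ j, (u t x j / θ t x) * ((ρ t x • u t x) j) = ρ t x * ‖u t x‖ ^ 2 / θ t x := by
      intro x
      simp only [PiLp.smul_apply, smul_eq_mul]
      rw [EuclideanSpace.norm_sq_eq]
      simp only [Real.norm_eq_abs, sq_abs]
      rw [mul_div_assoc, Finset.sum_div, Finset.mul_sum]
      exact Finset.sum_congr rfl fun j _ => by ring
    have hpt : ∀ x, (Real.log (ρ t x * Real.exp (hsExcessFreeEnergy (ρ t x * σ ^ 3) +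
          ρ t x * σ ^ 3 * deriv hsExcessFreeEnergy (ρ t x * σ ^ 3))) +
          Real.log ((2 * Real.pi * θ t x) ^ (-(Module.finrank ℝ V3 : ℝ) / 2)) - ‖u t x‖ ^ 2 / (2 * θ t x)) * ρ t x +
        (∑ j, (u t x j / θ t x) * ((ρ t x • u t x) j)) -
        (θ t x)⁻¹ * totalEnergyDensity (ρ t x) (u t x) (θ t x) =
        ρ t x * (ρ t x * σ ^ 3 * deriv hsExcessFreeEnergy (ρ t x * σ ^ 3)) -
          ρ t x * (3 / 2 * Real.log (θ t x) - Real.log (ρ t x) - hsExcessFreeEnergy (ρ t x * σ ^ 3)) -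
          3 / 2 * Real.log (2 * Real.pi) * ρ t x - 3 / 2 * ρ t x := by
      intro x
      have hθx := (hθtpos x).ne'
      rw [hsum x, Real.log_mul (hρtpos x).ne' (Real.exp_pos _).ne', Real.log_exp, hfin,
        Real.log_rpow (mul_pos h2π (hθtpos x)), Real.log_mul h2π.ne' hθx]
      unfold totalEnergyDensity
      field_simp
      ring
    have hbc : Continuous fun x => ρ t x * Real.exp (hsExcessFreeEnergy (ρ t x * σ ^ 3) +
        ρ t x * σ ^ 3 * deriv hsExcessFreeEnergy (ρ t x * σ ^ 3)) :=
      continuous_refActivity hσ hf hρtc hρtpos (hband t ht)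
    have hb0 : ∀ x, 0 < ρ t x * Real.exp (hsExcessFreeEnergy (ρ t x * σ ^ 3) +
        ρ t x * σ ^ 3 * deriv hsExcessFreeEnergy (ρ t x * σ ^ 3)) := fun x => mul_pos (hρtpos x) (Real.exp_pos _)
    have hI1 : Integrable (fun x => (Real.log (ρ t x * Real.exp (hsExcessFreeEnergy (ρ t x * σ ^ 3) +
        ρ t x * σ ^ 3 * deriv hsExcessFreeEnergy (ρ t x * σ ^ 3))) +
        Real.log ((2 * Real.pi * θ t x) ^ (-(Module.finrank ℝ V3 : ℝ) / 2)) - ‖u t x‖ ^ 2 / (2 * θ t x)) * ρ t x) := by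
      refine integrable_of_continuous_T3 (Continuous.mul ?_ hρtc)
      have hRc : Continuous fun x => (2 * Real.pi * θ t x) ^ (-(Module.finrank ℝ V3 : ℝ) / 2) :=
        (continuous_const.mul hθtc).rpow_const fun x => Or.inl (mul_pos h2π (hθtpos x)).ne'
      refine ((hbc.log fun x => (hb0 x).ne').add (hRc.log fun x =>
        (Real.rpow_pos_of_pos (mul_pos h2π (hθtpos x)) _).ne')).sub ?_
      exact (hutc.norm.pow 2).div (continuous_const.mul hθtc) fun x => (mul_pos two_pos (hθtpos x)).ne'
    have hI2 : ∀ j : Fin 3, Integrable (fun x => (u t x j / θ t x) * ((ρ t x • u t x) j)) := fun j =>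
      integrable_of_continuous_T3 ((((EuclideanSpace.proj j : V3 →L[ℝ] ℝ).continuous.comp hutc).div hθtc
        fun x => (hθtpos x).ne').mul ((EuclideanSpace.proj j : V3 →L[ℝ] ℝ).continuous.comp (hρtc.smul hutc)))
    have hI3 : Integrable (fun x => (θ t x)⁻¹ * totalEnergyDensity (ρ t x) (u t x) (θ t x)) := by
      refine integrable_of_continuous_T3 ((hθtc.inv₀ fun x => (hθtpos x).ne').mul ?_)
      unfold totalEnergyDensity
      fun_prop
    have hJ1 : Integrable (fun x => ρ t x * (ρ t x * σ ^ 3 * deriv hsExcessFreeEnergy (ρ t x * σ ^ 3))) :=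
      integrable_of_continuous_T3 (hρtc.mul ((hρtc.mul continuous_const).mul hftc'))
    have hJ2 : Integrable (fun x => ρ t x * (3 / 2 * Real.log (θ t x) - Real.log (ρ t x) -
        hsExcessFreeEnergy (ρ t x * σ ^ 3))) :=
      integrable_of_continuous_T3 (hρtc.mul (((continuous_const.mul (hθtc.log fun x => (hθtpos x).ne')).sub
        (hρtc.log fun x => (hρtpos x).ne')).sub hftc))
    have hJ3 : Integrable (fun x => 3 / 2 * Real.log (2 * Real.pi) * ρ t x) :=
      integrable_of_continuous_T3 (continuous_const.mul hρtc)
    have hJ4 : Integrable (fun x => 3 / 2 * ρ t x) := integrable_of_continuous_T3 (continuous_const.mul hρtc)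
    have hS2 : Integrable (fun x => ∑ j, (u t x j / θ t x) * ((ρ t x • u t x) j)) :=
      integrable_finsetSum _ fun j _ => hI2 j
    have hS12 : Integrable (fun x => (Real.log (ρ t x * Real.exp (hsExcessFreeEnergy (ρ t x * σ ^ 3) +
        ρ t x * σ ^ 3 * deriv hsExcessFreeEnergy (ρ t x * σ ^ 3))) +
        Real.log ((2 * Real.pi * θ t x) ^ (-(Module.finrank ℝ V3 : ℝ) / 2)) - ‖u t x‖ ^ 2 / (2 * θ t x)) * ρ t x +
        ∑ j, (u t x j / θ t x) * ((ρ t x • u t x) j)) := hI1.add hS2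
    have hK1 : Integrable (fun x => ρ t x * (ρ t x * σ ^ 3 * deriv hsExcessFreeEnergy (ρ t x * σ ^ 3)) -
        ρ t x * (3 / 2 * Real.log (θ t x) - Real.log (ρ t x) - hsExcessFreeEnergy (ρ t x * σ ^ 3))) := hJ1.sub hJ2
    have hK2 : Integrable (fun x => ρ t x * (ρ t x * σ ^ 3 * deriv hsExcessFreeEnergy (ρ t x * σ ^ 3)) -
        ρ t x * (3 / 2 * Real.log (θ t x) - Real.log (ρ t x) - hsExcessFreeEnergy (ρ t x * σ ^ 3)) -
        3 / 2 * Real.log (2 * Real.pi) * ρ t x) := hK1.sub hJ3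
    rw [← integral_finsetSum _ fun j _ => hI2 j, ← integral_add hI1 hS2, ← integral_sub hS12 hI3,
      integral_congr_ae (Eventually.of_forall hpt), integral_sub hK2 hJ4,
      integral_sub hK1 hJ3, integral_sub hJ1 hJ2, integral_const_mul, integral_const_mul, hmasst]
    ring
  rw [e1, e2]
  linarith [hS]

/-! ### §3 The KL core from convergence of the mean empirical fields -/

/-- Scaling the one-particle profile by a constant scales the canonical partition function by its
`n`-th power. [folklore] -/
theorem canonicalPartition_const_mul {n : ℕ} (k ε : ℝ) (f : T3 × V3 → ℝ) :
    canonicalPartition (Torus.geometry (Fin 3)) ε n (fun y => k * f y) =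
      k ^ n * canonicalPartition (Torus.geometry (Fin 3)) ε n f := by
  unfold canonicalPartition
  rw [KineticWindowGronwallNegative.tensorPow_const_mul]
  have h : (hardSphereDomain (Torus.geometry (Fin 3)) n ε).indicator
      (fun z : Config n (Fin 3) T3 => k ^ n * tensorPow n f z) =
      fun z => k ^ n * (hardSphereDomain (Torus.geometry (Fin 3)) n ε).indicator (tensorPow n f) z := by
    funext z
    by_cases hz : z ∈ hardSphereDomain (Torus.geometry (Fin 3)) n ε <;> simp [hz]
  rw [h, integral_const_mul]

/-- A real sequence tending to `0`, lifted to `ℝ≥0∞`, tends to `0`. [folklore] -/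
theorem tendsto_ofReal_zero {r : ℕ → ℝ} (h : Tendsto r atTop (𝓝 0)) :
    Tendsto (fun N => ENNReal.ofReal (r N)) atTop (𝓝 0) := by
  simpa using ENNReal.tendsto_ofReal h

/-- **Yau's estimate at the Euler-driven reference from convergence of the mean empirical fields** (step (d) of
item `BlockGibbsToRelEntropy`). Fix `0 < σ < 1/2`, continuous positive profiles `(a₀, u₀, θ₀)`, a classical
hard-sphere-Euler solution `(ρ, u, θ)` on `[0, T)` in the analytic band (`f_ex` smooth on `(0, η₀)`,
`ρ σ³ < η₀`), tied at `t = 0` to the local Gibbs laws through the flow family `Φ`, with `θ(0) = θ₀` and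
`a₀ = e^c ρ₀ e^{g_σ(ρ₀)}`, and a time `t ∈ [0, T)`. ASSUME the two local-density limits of the log-partition
functions at `ρ₀` and `ρ_t` (conclusion (B) of `HardSphereLDA`) and CONVERGENCE OF THE MEAN EMPIRICAL FIELDS:
of the density field at time `0`, and of the density, momentum and energy fields of `Φ_t z` at time `t`, to
the Euler fields. THEN the specific relative entropy of the law at time `t` with respect to the local Gibbs law
of the Euler-driven reference `(ρ_t e^{g_σ(ρ_t)}, u_t, θ_t)` vanishes:
`KL(lawAt Φ_N λ_N t ‖ localGibbsLaw σ (ρ_t e^{g_σ(ρ_t)}) u_t θ_t)/(N+1) → 0`. [cite: Yau1991, §2] -/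
theorem klCore_at_of_meanFields (hσ : 0 < σ) (hσ2 : σ < 2⁻¹) (ha : Continuous a₀) (hθ : Continuous θ₀)
    (hu : Continuous u₀) (ha0 : ∀ x, 0 < a₀ x) (hθ0 : ∀ x, 0 < θ₀ x)
    (hf : ContDiffOn ℝ ∞ hsExcessFreeEnergy (Ioo 0 η₀)) (hE : IsHardSphereEulerSolution σ T ρ u θ)
    (hband : ∀ s ∈ Ico 0 T, ∀ x, ρ s x * σ ^ 3 < η₀)
    (Φ : (N : ℕ) → HardSphereFlow (Torus.geometry (Fin 3)) (hsDiameter σ N) (N + 1))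
    (htie : TendstoHydroFieldsAt (fun N => localGibbsLaw σ a₀ u₀ θ₀ N (Φ N)) Φ ρ u θ 0)
    (hθeq : θ 0 = θ₀) {c : ℝ}
    (harepr : ∀ x, a₀ x = Real.exp c * (ρ 0 x * Real.exp (hsExcessFreeEnergy (ρ 0 x * σ ^ 3) +
      ρ 0 x * σ ^ 3 * deriv hsExcessFreeEnergy (ρ 0 x * σ ^ 3))))
    {t : ℝ} (ht : t ∈ Ico 0 T)
    (hZ0 : Tendsto (fun N : ℕ => ((N : ℝ) + 1)⁻¹ * Real.log (canonicalPartition (Torus.geometry (Fin 3))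
      (hsDiameter σ N) (N + 1) (localGibbsProfile (fun x => ρ 0 x * Real.exp (hsExcessFreeEnergy (ρ 0 x * σ ^ 3) +
        ρ 0 x * σ ^ 3 * deriv hsExcessFreeEnergy (ρ 0 x * σ ^ 3))) u₀ θ₀))) atTop
      (𝓝 (∫ x, ρ 0 x * (ρ 0 x * σ ^ 3 * deriv hsExcessFreeEnergy (ρ 0 x * σ ^ 3)))))
    (hZt : Tendsto (fun N : ℕ => ((N : ℝ) + 1)⁻¹ * Real.log (canonicalPartition (Torus.geometry (Fin 3))
      (hsDiameter σ N) (N + 1) (localGibbsProfile (fun x => ρ t x * Real.exp (hsExcessFreeEnergy (ρ t x * σ ^ 3) +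
        ρ t x * σ ^ 3 * deriv hsExcessFreeEnergy (ρ t x * σ ^ 3))) (u t) (θ t)))) atTop
      (𝓝 (∫ x, ρ t x * (ρ t x * σ ^ 3 * deriv hsExcessFreeEnergy (ρ t x * σ ^ 3)))))
    (hD0 : ∀ χ : T3 → ℝ, Continuous χ → Tendsto (fun N : ℕ => ∫ z, empiricalDensityField z χ
      ∂(localGibbsLaw σ a₀ u₀ θ₀ N (Φ N))) atTop (𝓝 (∫ x, χ x * ρ 0 x)))
    (hDt : ∀ χ : T3 → ℝ, Continuous χ → Tendsto (fun N : ℕ => ∫ z, empiricalDensityField ((Φ N).flow t z) χ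
      ∂(localGibbsLaw σ a₀ u₀ θ₀ N (Φ N))) atTop (𝓝 (∫ x, χ x * ρ t x)))
    (hMt : ∀ χ : T3 → ℝ, Continuous χ → ∀ j : Fin 3,
      Tendsto (fun N : ℕ => ∫ z, empiricalMomentumField ((Φ N).flow t z) χ j
        ∂(localGibbsLaw σ a₀ u₀ θ₀ N (Φ N))) atTop (𝓝 (∫ x, χ x * (ρ t x • u t x) j)))
    (hEt : ∀ χ : T3 → ℝ, Continuous χ → Tendsto (fun N : ℕ => ∫ z, empiricalEnergyField ((Φ N).flow t z) χ
      ∂(localGibbsLaw σ a₀ u₀ θ₀ N (Φ N))) atTop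
        (𝓝 (∫ x, χ x * totalEnergyDensity (ρ t x) (u t x) (θ t x)))) :
    Tendsto (fun N : ℕ => klDiv ((Φ N).lawAt (localGibbsLaw σ a₀ u₀ θ₀ N (Φ N)) t)
        (localGibbsLaw σ (fun x => ρ t x * Real.exp (hsExcessFreeEnergy (ρ t x * σ ^ 3) +
          ρ t x * σ ^ 3 * deriv hsExcessFreeEnergy (ρ t x * σ ^ 3))) (u t) (θ t) N (Φ N)) /
        ((N : ℝ≥0∞) + 1)) atTop (𝓝 0) := by
  have hσ2' : σ ≤ 1 / 2 := by rw [one_div]; exact hσ2.le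
  have h0 : (0 : ℝ) ∈ Ico 0 T := ⟨le_rfl, ht.1.trans_lt ht.2⟩
  -- the Euler fields at times `0` and `t`
  have hρ0c : Continuous (ρ 0) := (hE.smooth_density.isSmooth_slice h0).continuous
  have hρtc : Continuous (ρ t) := (hE.smooth_density.isSmooth_slice ht).continuous
  have hθtc : Continuous (θ t) := (hE.smooth_temperature.isSmooth_slice ht).continuous
  have hutc : Continuous (u t) := (hE.smooth_velocity.isSmooth_slice ht).continuous
  have hρ0pos : ∀ x, 0 < ρ 0 x := hE.density_pos 0 h0
  have hρtpos : ∀ x, 0 < ρ t x := hE.density_pos t ht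
  have hθtpos : ∀ x, 0 < θ t x := hE.temperature_pos t ht
  -- the two reference activities
  set b0 : T3 → ℝ := fun x => ρ 0 x * Real.exp (hsExcessFreeEnergy (ρ 0 x * σ ^ 3) +
    ρ 0 x * σ ^ 3 * deriv hsExcessFreeEnergy (ρ 0 x * σ ^ 3)) with hb0def
  set bt : T3 → ℝ := fun x => ρ t x * Real.exp (hsExcessFreeEnergy (ρ t x * σ ^ 3) +
    ρ t x * σ ^ 3 * deriv hsExcessFreeEnergy (ρ t x * σ ^ 3)) with hbtdef
  have hb0c : Continuous b0 := continuous_refActivity hσ hf hρ0c hρ0pos (hband 0 h0)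
  have hbtc : Continuous bt := continuous_refActivity hσ hf hρtc hρtpos (hband t ht)
  have hb0pos : ∀ x, 0 < b0 x := fun x => mul_pos (hρ0pos x) (Real.exp_pos _)
  have hbtpos : ∀ x, 0 < bt x := fun x => mul_pos (hρtpos x) (Real.exp_pos _)
  -- unit masses
  have hmass0 : ∫ x, ρ 0 x = 1 := DenseExcursionEverywhere.integral_density_zero_eq_one hσ2' ha hθ hu ha0 hθ0 Φ htie
  have hmasst : ∫ x, ρ t x = 1 := by rw [DenseExcursionEverywhere.integral_density_eq hE ht, hmass0]
  -- the initial partition function through the scaled activity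
  have hprof : localGibbsProfile a₀ u₀ θ₀ = fun y => Real.exp c * localGibbsProfile b0 u₀ θ₀ y := by
    rw [← localGibbsProfile_const_mul]
    congr 1
    funext x
    exact harepr x
  have hZa : ∀ N : ℕ, Real.log (canonicalPartition (Torus.geometry (Fin 3)) (hsDiameter σ N) (N + 1)
      (localGibbsProfile a₀ u₀ θ₀)) = ((N : ℝ) + 1) * c +
      Real.log (canonicalPartition (Torus.geometry (Fin 3)) (hsDiameter σ N) (N + 1) (localGibbsProfile b0 u₀ θ₀)) := by
    intro N
    have hZpos := canonicalPartition_localGibbs_pos hσ2' N hb0c hθ hu hb0pos hθ0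
    rw [hprof, canonicalPartition_const_mul, Real.log_mul (pow_ne_zero _ (Real.exp_pos c).ne') hZpos.ne',
      Real.log_pow, Real.log_exp]
    push_cast
    ring
  -- the four limits
  have hA := tendsto_integral_logPair_zero hσ2' ha hθ hu ha0 hθ0 Φ hD0
  have hK : ∀ N : ℕ, Integrable (fun z => ∫ y, ‖y.2‖ ^ 2 ∂(empiricalMeasure ((Φ N).flow t z)))
      (localGibbsLaw σ a₀ u₀ θ₀ N (Φ N)) := fun N =>
    integrable_kineticPair_flow_localGibbsLaw hσ2' ha hθ hu ha0 hθ0 N (Φ N) t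
  haveI : ∀ N : ℕ, IsProbabilityMeasure (localGibbsLaw σ a₀ u₀ θ₀ N (Φ N)) := fun N =>
    isProbabilityMeasure_localGibbsLaw ha hθ hu ha0 hθ0 hσ2' N (Φ N)
  have hB := tendsto_integral_logPair_comp (b := bt) (ϑ := θ t) (w := u t)
    (fun N => localGibbsLaw σ a₀ u₀ θ₀ N (Φ N)) (fun N => (Φ N).flow t) (fun N => (Φ N).measurable_flow t)
    hbtc hθtc hutc hbtpos hθtpos hK (ρ₁ := ρ t) (e := fun x => totalEnergyDensity (ρ t x) (u t x) (θ t x))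
    (m := fun x => ρ t x • u t x) hDt hMt hEt
  have hZ0' : Tendsto (fun N : ℕ => ((N : ℝ) + 1)⁻¹ * Real.log (canonicalPartition (Torus.geometry (Fin 3))
      (hsDiameter σ N) (N + 1) (localGibbsProfile a₀ u₀ θ₀))) atTop
      (𝓝 (c + ∫ x, ρ 0 x * (ρ 0 x * σ ^ 3 * deriv hsExcessFreeEnergy (ρ 0 x * σ ^ 3)))) := by
    have h := hZ0.const_add c
    refine h.congr fun N => ?_
    rw [hZa N, mul_add, ← mul_assoc, inv_mul_cancel₀ (by positivity : ((N : ℝ) + 1) ≠ 0), one_mul]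
  -- the real sequence
  set r : ℕ → ℝ := fun N => (klDiv ((Φ N).lawAt (localGibbsLaw σ a₀ u₀ θ₀ N (Φ N)) t)
    (localGibbsLaw σ bt (u t) (θ t) N (Φ N))).toReal / ((N : ℝ) + 1) with hrdef
  have hr : ∀ N : ℕ, r N =
      (∫ z, (∫ y, Real.log (localGibbsProfile a₀ u₀ θ₀ y) ∂(empiricalMeasure z)) ∂(localGibbsLaw σ a₀ u₀ θ₀ N (Φ N))) -
        (∫ z, (∫ y, Real.log (localGibbsProfile bt (u t) (θ t) y) ∂(empiricalMeasure ((Φ N).flow t z)))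
          ∂(localGibbsLaw σ a₀ u₀ θ₀ N (Φ N))) +
        ((N : ℝ) + 1)⁻¹ * Real.log (canonicalPartition (Torus.geometry (Fin 3)) (hsDiameter σ N) (N + 1)
          (localGibbsProfile bt (u t) (θ t))) -
        ((N : ℝ) + 1)⁻¹ * Real.log (canonicalPartition (Torus.geometry (Fin 3)) (hsDiameter σ N) (N + 1)
          (localGibbsProfile a₀ u₀ θ₀)) := by
    intro N
    have hN : ((N : ℝ) + 1) ≠ 0 := by positivity
    rw [hrdef]
    dsimp only
    rw [toReal_klDiv_lawAt_localGibbsLaw_eq hσ hσ2 ha hθ hu ha0 hθ0 hbtc hθtc hutc hbtpos hθtpos N (Φ N) t]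
    field_simp
  have hlim : Tendsto r atTop (𝓝 0) := by
    have h := ((hA.sub hB).add hZt).sub hZ0'
    rw [bookkeeping_limit_eq_zero hσ hf hE hband ht hθ0 hθeq harepr hmass0 hmasst] at h
    exact h.congr fun N => (hr N).symm
  -- back to `ℝ≥0∞`
  have hconv : ∀ N : ℕ, klDiv ((Φ N).lawAt (localGibbsLaw σ a₀ u₀ θ₀ N (Φ N)) t)
      (localGibbsLaw σ bt (u t) (θ t) N (Φ N)) / ((N : ℝ≥0∞) + 1) = ENNReal.ofReal (r N) := by
    intro N
    have hfin := klDiv_lawAt_localGibbsLaw_ne_top hσ2' ha hθ hu ha0 hθ0 hbtc hθtc hutc hbtpos hθtpos N (Φ N) t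
    rw [hrdef]
    dsimp only
    rw [ENNReal.ofReal_div_of_pos (by positivity : (0 : ℝ) < (N : ℝ) + 1), ENNReal.ofReal_toReal hfin]
    congr 1
    rw [ENNReal.ofReal_add (by positivity) zero_le_one, ENNReal.ofReal_natCast, ENNReal.ofReal_one]
  simp_rw [hconv]
  exact tendsto_ofReal_zero hlim

end Summit.AtomisticToContinuum.HydrodynamicLimit.Theorems.JaynesSqueezeClosure

end
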